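import Mathlib
import Literature.NumberTheory.LFunctions.Zhang2022.AppendixALemma83Generic
import Literature.NumberTheory.LFunctions.Zhang2022.AppendixAEqA4
import HarnessLib

/-!
# Zhang (2022), Appendix A part 1 (proof of Lemma 8.3): the tail of the Euler product of
# `𝒰_j(d,h;s)` on `σ > 9/10` — `∏'_q 𝔱_j = ∏_{q<D} 𝔱_j + O(D^{−3/10})` in ABSOLUTE form, kernel-checked

Topic `Literature/NumberTheory/LFunctions/Zhang2022` (Landau–Siegel audit tree; verdict-neutral).
Y. Zhang, *Discrete mean estimates and the Landau–Siegel zero*, arXiv:2211.02515v1 (2022)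
[Zhang2022LandauSiegel], Appendix A p. 101, tex L4999–L5002, **an unrefereed manuscript under
adjudication; nothing here asserts or denies its Theorems 1–2.** The sentence

> so `𝒰_j(d,h;s)` is analytic in this region, and `𝒰_j(d,h;s) = λ(dh,1−β_j)∏_{q<D}𝔱_j(d,h₁,s;q) + O(D^{−c})`

is typed (prefactor-free reading of record, flags F1/F2 of `TypedAppendixA1`) as
`Typed.AppendixA1.StepA_u007_read c′`: for EVERY continuation `U` of `𝒰_j(d,h;·)` to `σ > 9/10` and every
`s` there, `‖U(s) − ∏_{q<D}𝔱_j(d,h,s;q)‖ ≤ C·D^{−c}` — an ABSOLUTE error, uniformly in `σ > 9/10` and in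
`d, h` with `dh < PT⁻²`. This file PROVES the Euler-product half of that sentence over the tree's objects
(`Typed.AppendixA1.frakt` = `𝔱_j`), with no input from the manuscript left open:

* `norm_frakt_sub_one_le_of_dvd` — at the primes `q ∣ dh`: `‖𝔱_j − 1‖ ≤ 4q^{−σ}` on `σ > 9/10` (from the
  closed forms `Lemma83.frakt_eq_of_dvd_right/left`, Cases 2–3 of the printed proof);
* `norm_frakt_sub_one_le_all` — every prime: `‖𝔱_j − 1‖ ≤ 26·10⁶q^{−9/5} + [q ∣ dh]·4q^{−9/10}`
  (with `Lemma83.norm_frakt_sub_one_le` for `(q,dh) = 1`);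
* `multipliable_frakt` — the Euler product `∏'_q 𝔱_j(d,h,s;q)` converges (unconditionally) on `σ > 9/10`;
* `sum_primeFactors_rpow_le` — `Σ_{q∣n} q^{−9/10} ≤ 12𝓛^{9/10}` for `n < P = e^{𝓛⁹}` (rearrangement onto the
  first `ω(n) ≤ 2𝓛⁹` integers `≥ 2` and an integral comparison);
* **`norm_tprod_frakt_sub_prod_le`** — for `D ≥ D₁` (absolute), every Dirichlet character `χ` mod `D`,
  `j ∈ {1,2,3}`, `d, h ≥ 1` with `dh < P`, and every `σ > 9/10`:
  `‖∏'_q 𝔱_j − ∏_{q<D} 𝔱_j‖ ≤ C·D^{−3/10}` with an ABSOLUTE `C`.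
  The tail `∏_{q≥D}` is `1 + O(D^{−1/2})` (`q^{−9/5} ≤ D^{−1/2}q^{−13/10}`; at most `𝓛⁸` primes `q ≥ D`
  divide `dh`, `Typed.AppendixA1.card_primeFactors_ge_le`), while the finite part is only
  `≪ exp(4Σ_{q∣dh}q^{−9/10}) ≤ exp(48𝓛^{9/10}) ≤ D^{1/5}` once `𝓛 ≥ 240¹⁰` — the absolute form costs this
  astronomically large (but effective) threshold, which `Skeleton.ForAllLarge` permits.

The companion file `AppendixAStepAu007Read` combines this with the identity theorem to obtain
`StepA_u007_read` from the holomorphy of `s ↦ ∏'_q 𝔱_j` and its identification with `calU` on `σ > 1`.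
WHAT THIS IS NOT: a proof that `∏'_q 𝔱_j` is holomorphic or equals `𝒰_j` on `σ > 1` (leaf `hAn`, seat
zl-w09-p1), or of anything about Theorems 1–2 / Landau–Siegel zeros.

## References

* Y. Zhang, arXiv:2211.02515v1 (2022), Appendix A p. 101 (tex L4999–L5002); §8 Lemma 8.3 p. 46.
  [cite: Zhang2022LandauSiegel, App. A]
-/

noncomputable section

open Complex Real Filter Topology Finset

namespace Literature.NumberTheory.LFunctions.Zhang2022.Lemma83

open Literature.NumberTheory.LFunctions.Zhang2022
open Literature.NumberTheory.LFunctions.Zhang2022.Skeleton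
open Literature.NumberTheory.LFunctions.Zhang2022.Typed.AppendixA1

/-! ## The local factor at the primes dividing `dh`: `𝔱_j = 1 + O(q^{−σ})` -/

/-- `2^{−1/2} ≤ 71/100` (`√2 > 1.41`). [folklore] -/
private theorem two_rpow_neg_half_le' : (2 : ℝ) ^ (-(1 / 2 : ℝ)) ≤ 71 / 100 := by
  rw [Real.rpow_neg (by norm_num), ← Real.sqrt_eq_rpow]
  have h : (141 / 100 : ℝ) < Real.sqrt 2 := by
    rw [Real.lt_sqrt (by norm_num)]; norm_num
  rw [inv_le_comm₀ (by positivity) (by norm_num)]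
  linarith

/-- For `σ > 9/10` and a prime `q`: `q^{−σ} ≤ 71/100`. [folklore] -/
private theorem rpow_neg_re_le' {q : ℕ} (hq : q.Prime) {s : ℂ} (hs : 9 / 10 < s.re) :
    (q : ℝ) ^ (-s.re) ≤ 71 / 100 := by
  have hq2 : (2 : ℝ) ≤ q := by exact_mod_cast hq.two_le
  calc (q : ℝ) ^ (-s.re) ≤ (q : ℝ) ^ (-(1 / 2 : ℝ)) :=
        Real.rpow_le_rpow_of_exponent_le (by linarith) (by linarith)
    _ ≤ (2 : ℝ) ^ (-(1 / 2 : ℝ)) :=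
        Real.rpow_le_rpow_of_nonpos (by norm_num) hq2 (by norm_num)
    _ ≤ 71 / 100 := two_rpow_neg_half_le'

/-- `‖ab/(1 − a)‖ ≤ 4x` when `‖a‖ ≤ x ≤ 71/100` and `‖b‖ ≤ 1`. [folklore] -/
private theorem norm_mul_div_one_sub_le {a b : ℂ} {x : ℝ} (ha : ‖a‖ ≤ x) (hx : x ≤ 71 / 100)
    (hb : ‖b‖ ≤ 1) : ‖a * b / (1 - a)‖ ≤ 4 * x := by
  have hx0 : 0 ≤ x := le_trans (norm_nonneg _) ha
  have hden : 1 - x ≤ ‖1 - a‖ := by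
    linarith [norm_le_norm_add_norm_sub' (1 : ℂ) a, norm_one (α := ℂ)]
  have hpos : 0 < 1 - x := by linarith
  have hden0 : 0 < ‖1 - a‖ := lt_of_lt_of_le hpos hden
  rw [norm_div, norm_mul, div_le_iff₀ hden0]
  have h1 : ‖a‖ * ‖b‖ ≤ x :=
    calc ‖a‖ * ‖b‖ ≤ ‖a‖ * 1 := mul_le_mul_of_nonneg_left hb (norm_nonneg _)
      _ ≤ x := by rw [mul_one]; exact ha
  have h2 : x ≤ 4 * x * (1 - x) := by nlinarith
  have h3 : 4 * x * (1 - x) ≤ 4 * x * ‖1 - a‖ := mul_le_mul_of_nonneg_left hden (by positivity)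
  linarith

/-- **At the primes dividing `dh`: `𝔱_j(d,h,s;q) = 1 + O(q^{−σ})` on `σ > 9/10`** — precisely
`‖𝔱_j − 1‖ ≤ 4q^{−σ}` for `q ∣ dh`, `1 ≤ j ≤ 3`, any `D` and any Dirichlet character (Case 2:
`𝔱_j = 1/(1 − a)`, Case 3: `𝔱_j = (1 − (q/(q−1))a)/(1 − a)`, `a = χ(q)q^{−s}q^{−β_j}`, `|a| ≤ q^{−σ} ≤ 0.71`).
The printed proof evaluates these factors only near `s = 1` ((A.2)–(A.3)); §15 p. 84 states the
analogous "trivially `1 + O(q^{−9/10})`" for `𝓜₁`. [cite: Zhang2022LandauSiegel, App. A pp. 102–103] -/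
theorem norm_frakt_sub_one_le_of_dvd (c' : ℝ) {D : ℕ} (χ : DirichletCharacter ℂ D) {j : ℕ}
    (hj : j ∈ ({1, 2, 3} : Finset ℕ)) {d h q : ℕ} (hd : 1 ≤ d) (hh : 1 ≤ h) (hq : q.Prime)
    (hqdh : q ∣ d * h) (s : ℂ) (hs : 9 / 10 < s.re) :
    ‖frakt c' χ j d h s q - 1‖ ≤ 4 * (q : ℝ) ^ (-s.re) := by
  have hs0 : 0 < s.re := by linarith
  set X : ℂ := (q : ℂ) ^ (-s) with hX
  set v : ℂ := χ (q : ZMod D) with hv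
  set w : ℂ := (q : ℂ) ^ (-betaJ c' D j) with hw
  set x : ℝ := (q : ℝ) ^ (-s.re) with hxdef
  have hx : x ≤ 71 / 100 := rpow_neg_re_le' hq hs
  have hXn : ‖X‖ = x := by
    rw [hX, Complex.norm_natCast_cpow_of_pos hq.pos, Complex.neg_re]
  have hvn : ‖v‖ ≤ 1 := χ.norm_le_one _
  have hwn : ‖w‖ = 1 := by
    rw [hw, Complex.norm_natCast_cpow_of_pos hq.pos, Complex.neg_re,
      Section8PerronSteps.betaJ_re, neg_zero, Real.rpow_zero]
  have hx0 : 0 ≤ x := by positivity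
  have ha : ‖v * X * w‖ ≤ x := by
    rw [norm_mul, norm_mul, hwn, hXn, mul_one]; nlinarith [norm_nonneg v]
  have hne : 1 - v * X * w ≠ 0 := by
    intro h0
    have h1 : v * X * w = 1 := (sub_eq_zero.mp h0).symm
    have : ‖v * X * w‖ = 1 := by rw [h1, norm_one]
    linarith
  -- Case 2: `q ∣ h`
  have caseH : q ∣ h → ‖frakt c' χ j d h s q - 1‖ ≤ 4 * x := by
    intro hqh
    rw [frakt_eq_of_dvd_right c' χ hj hd hh hq hqh s hs0]
    have e : 1 / (1 - v * X * w) - 1 = (v * X * w) * 1 / (1 - v * X * w) := by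
      field_simp
      ring
    rw [e]
    exact norm_mul_div_one_sub_le ha hx (by rw [norm_one])
  rcases (Nat.Prime.dvd_mul hq).mp hqdh with hqd | hqh
  · by_cases hqh : q ∣ h
    · exact caseH hqh
    · -- Case 3: `q ∣ d`, `q ∤ h`
      rw [frakt_eq_of_dvd_left c' χ hj hd hh hq hqd hqh s hs0]
      have hq2 : (2 : ℝ) ≤ q := by exact_mod_cast hq.two_le
      have h1 : (q : ℂ) - 1 = (((q : ℝ) - 1 : ℝ) : ℂ) := by push_cast; ring
      have hne1 : (q : ℂ) - 1 ≠ 0 := by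
        rw [h1]; exact_mod_cast (show (q : ℝ) - 1 ≠ 0 by linarith)
      have hc₀ : ‖1 - (q : ℂ) / ((q : ℂ) - 1)‖ ≤ 1 := by
        have e : 1 - (q : ℂ) / ((q : ℂ) - 1) = -1 / ((q : ℂ) - 1) := by
          field_simp
          ring
        rw [e, norm_div, norm_neg, norm_one, h1, Complex.norm_real, Real.norm_eq_abs,
          abs_of_nonneg (by linarith), div_le_one (by linarith)]
        linarith
      have e : (1 - (q : ℂ) / ((q : ℂ) - 1) * (v * X * w)) / (1 - v * X * w) - 1 =
          (v * X * w) * (1 - (q : ℂ) / ((q : ℂ) - 1)) / (1 - v * X * w) := by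
        field_simp
        ring
      rw [e]
      exact norm_mul_div_one_sub_le ha hx hc₀
  · exact caseH hqh

/-- **Every prime: `‖𝔱_j(d,h,s;q) − 1‖ ≤ 26·10⁶·q^{−9/5} + [q ∣ dh]·4q^{−9/10}` on `σ > 9/10`**
(`(q,dh) = 1`: `Lemma83.norm_frakt_sub_one_le`, tex L4999; `q ∣ dh`: `norm_frakt_sub_one_le_of_dvd`
with `q^{−σ} ≤ q^{−9/10}`). Any `D`, any Dirichlet character. [cite: Zhang2022LandauSiegel, App. A p. 101] -/
theorem norm_frakt_sub_one_le_all (c' : ℝ) {D : ℕ} (χ : DirichletCharacter ℂ D) {j : ℕ}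
    (hj : j ∈ ({1, 2, 3} : Finset ℕ)) {d h q : ℕ} (hd : 1 ≤ d) (hh : 1 ≤ h) (hq : q.Prime)
    (s : ℂ) (hs : 9 / 10 < s.re) :
    ‖frakt c' χ j d h s q - 1‖ ≤
      26000000 * (q : ℝ) ^ (-(9 / 5 : ℝ)) +
        (if q ∣ d * h then 4 * (q : ℝ) ^ (-(9 / 10 : ℝ)) else 0) := by
  have hq0 : (0 : ℝ) ≤ (q : ℝ) := Nat.cast_nonneg q
  have hq1 : (1 : ℝ) ≤ (q : ℝ) := by exact_mod_cast hq.one_lt.le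
  have hnn : 0 ≤ 26000000 * (q : ℝ) ^ (-(9 / 5 : ℝ)) := by positivity
  by_cases hqdh : q ∣ d * h
  · rw [if_pos hqdh]
    have h1 := norm_frakt_sub_one_le_of_dvd c' χ hj hd hh hq hqdh s hs
    have h2 : (q : ℝ) ^ (-s.re) ≤ (q : ℝ) ^ (-(9 / 10 : ℝ)) :=
      Real.rpow_le_rpow_of_exponent_le hq1 (by linarith)
    linarith
  · rw [if_neg hqdh, add_zero]
    have hqd : ¬ q ∣ d := fun h' => hqdh (dvd_mul_of_dvd_left h' h)
    have hqh : ¬ q ∣ h := fun h' => hqdh (dvd_mul_of_dvd_right h' d)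
    exact norm_frakt_sub_one_le c' χ hj hq hqd hqh hs

/-! ## Convergence of the Euler product on `σ > 9/10` -/

/-- The majorant `26·10⁶·q^{−9/5} + [q ∣ dh]·4q^{−9/10}` is summable over the primes (the first part by
`Σ n^{−9/5} < ∞`, the second is finitely supported). [folklore] -/
private theorem summable_majorant {d h : ℕ} (hdh : 0 < d * h) :
    Summable fun q : Nat.Primes =>
      26000000 * ((q : ℕ) : ℝ) ^ (-(9 / 5 : ℝ)) +
        (if (q : ℕ) ∣ d * h then 4 * ((q : ℕ) : ℝ) ^ (-(9 / 10 : ℝ)) else 0) := by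
  have hb1 : Summable fun q : Nat.Primes => 26000000 * ((q : ℕ) : ℝ) ^ (-(9 / 5 : ℝ)) := by
    have h : Summable fun n : ℕ => (n : ℝ) ^ (-(9 / 5 : ℝ)) :=
      Real.summable_nat_rpow.mpr (by norm_num)
    exact (h.comp_injective Subtype.val_injective).mul_left _
  set S₂ : Finset Nat.Primes := (d * h).primeFactors.subtype Nat.Prime with hS₂def
  have hb2 : Summable fun q : Nat.Primes =>
      (if (q : ℕ) ∣ d * h then 4 * ((q : ℕ) : ℝ) ^ (-(9 / 10 : ℝ)) else 0) := by
    refine summable_of_ne_finset_zero (s := S₂) fun q hq' => ?_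
    have hndvd : ¬ (q : ℕ) ∣ d * h := fun h' =>
      hq' (Finset.mem_subtype.mpr (Nat.mem_primeFactors.mpr ⟨q.prop, h', hdh.ne'⟩))
    rw [if_neg hndvd]
  exact hb1.add hb2

/-- **The Euler product `∏'_q 𝔱_j(d,h,s;q)` converges on `σ > 9/10`** (`Σ_q ‖𝔱_j − 1‖ < ∞` by
`norm_frakt_sub_one_le_all`; Mathlib `multipliable_one_add_of_summable`), for every `D`, every Dirichlet
character, `1 ≤ j ≤ 3`, `d, h ≥ 1`. [cite: Zhang2022LandauSiegel, App. A p. 101, tex L4999] -/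
theorem multipliable_frakt (c' : ℝ) {D : ℕ} (χ : DirichletCharacter ℂ D) {j : ℕ}
    (hj : j ∈ ({1, 2, 3} : Finset ℕ)) {d h : ℕ} (hd : 1 ≤ d) (hh : 1 ≤ h) (s : ℂ)
    (hs : 9 / 10 < s.re) :
    Multipliable fun q : Nat.Primes => frakt c' χ j d h s q := by
  have hdh : 0 < d * h := Nat.mul_pos hd hh
  have hsum : Summable fun q : Nat.Primes => ‖frakt c' χ j d h s q - 1‖ :=
    Summable.of_nonneg_of_le (fun _ => norm_nonneg _)
      (fun q => norm_frakt_sub_one_le_all c' χ hj hd hh q.prop s hs) (summable_majorant hdh)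
  have h := multipliable_one_add_of_summable hsum
  simpa only [add_sub_cancel] using h

/-! ## Folklore on products close to `1` -/

/-- `‖∏_{i∈A} g(i)‖ ≤ exp(Σ_{i∈A} ‖g(i) − 1‖)`. [folklore] -/
private theorem norm_prod_le_exp_sum {ι : Type*} (A : Finset ι) (g : ι → ℂ) :
    ‖∏ i ∈ A, g i‖ ≤ Real.exp (∑ i ∈ A, ‖g i - 1‖) := by
  have h := A.norm_prod_one_add_sub_one_le (fun i => g i - 1)
  simp only [add_sub_cancel] at h
  have h2 : ‖∏ i ∈ A, g i‖ ≤ ‖∏ i ∈ A, g i - 1‖ + ‖(1 : ℂ)‖ := by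
    have := norm_add_le (∏ i ∈ A, g i - 1) 1
    rwa [sub_add_cancel] at this
  rw [norm_one] at h2
  linarith

/-- `‖∏_{i∈A} g(i) − 1‖ ≤ exp(Σ_{i∈A} ‖g(i) − 1‖) − 1`. [folklore] -/
private theorem norm_prod_sub_one_le' {ι : Type*} (A : Finset ι) (g : ι → ℂ) :
    ‖∏ i ∈ A, g i - 1‖ ≤ Real.exp (∑ i ∈ A, ‖g i - 1‖) - 1 := by
  have h := A.norm_prod_one_add_sub_one_le (fun i => g i - 1)
  simpa only [add_sub_cancel] using h

/-- `eˣ − 1 ≤ x·eˣ`. [folklore] -/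
private theorem exp_sub_one_le_mul_exp' (x : ℝ) : Real.exp x - 1 ≤ x * Real.exp x := by
  have h := Real.add_one_le_exp (-x)
  have hx : Real.exp (-x) * Real.exp x = 1 := by rw [← Real.exp_add]; simp
  nlinarith [Real.exp_pos x, Real.exp_pos (-x)]

/-- Tail control for an unconditional product (as in `AppendixAEqA4`): `∏' F = a`, `b ≥ 0` summable,
`‖F(i) − 1‖ ≤ b(i)` off `S` ⇒ `‖a − ∏_S F‖ ≤ ‖∏_S F‖·(exp(Σ' b) − 1)`. [folklore] -/
private theorem norm_hasProd_sub_prod_le' {ι : Type*} {F : ι → ℂ} {a : ℂ} (hF : HasProd F a)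
    (S : Finset ι) {b : ι → ℝ} (hb0 : ∀ i, 0 ≤ b i) (hb : Summable b)
    (hFb : ∀ i ∉ S, ‖F i - 1‖ ≤ b i) :
    ‖a - ∏ i ∈ S, F i‖ ≤ ‖∏ i ∈ S, F i‖ * (Real.exp (∑' i, b i) - 1) := by
  classical
  set P := ∏ i ∈ S, F i with hPdef
  set R := ‖P‖ * (Real.exp (∑' i, b i) - 1) with hRdef
  have hA : ∀ A : Finset ι, S ≤ A → ‖∏ i ∈ A, F i - P‖ ≤ R := by
    intro A hSA
    have hsplit : ∏ i ∈ A, F i = P * ∏ i ∈ A \ S, F i := by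
      rw [hPdef, ← Finset.prod_sdiff hSA, mul_comm]
    have h1 : ‖∏ i ∈ A \ S, F i - 1‖ ≤ Real.exp (∑' i, b i) - 1 := by
      refine (norm_prod_sub_one_le' _ _).trans ?_
      have hle : ∑ i ∈ A \ S, ‖F i - 1‖ ≤ ∑' i, b i :=
        calc ∑ i ∈ A \ S, ‖F i - 1‖ ≤ ∑ i ∈ A \ S, b i :=
              Finset.sum_le_sum fun i hi => hFb i (Finset.mem_sdiff.mp hi).2
          _ ≤ ∑' i, b i := hb.sum_le_tsum _ (fun i _ => hb0 i)
      linarith [Real.exp_le_exp.mpr hle]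
    calc ‖∏ i ∈ A, F i - P‖ = ‖P * (∏ i ∈ A \ S, F i - 1)‖ := by rw [hsplit]; ring_nf
      _ = ‖P‖ * ‖∏ i ∈ A \ S, F i - 1‖ := norm_mul _ _
      _ ≤ R := mul_le_mul_of_nonneg_left h1 (norm_nonneg _)
  have hT : Tendsto (fun A : Finset ι => ∏ i ∈ A, F i) atTop (𝓝 a) := hF
  have hclosed : IsClosed {z : ℂ | ‖z - P‖ ≤ R} :=
    isClosed_le (continuous_id.sub continuous_const).norm continuous_const
  exact hclosed.mem_of_tendsto hT (Filter.eventually_atTop.mpr ⟨S, fun A hA' => hA A hA'⟩)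

/-! ## `Σ_{q∣n} q^{−9/10}` for `n < P` -/

/-- Rearrangement: a sum of an antitone `f` over a finite set of naturals `≥ 2` is at most the sum of
`f` over `{2, …, |S|+1}` (remove the maximum, which is `≥ |S| + 1`). [folklore] -/
private theorem sum_le_sum_range_of_antitone {f : ℕ → ℝ}
    (hf : ∀ m n : ℕ, 2 ≤ m → m ≤ n → f n ≤ f m) (S : Finset ℕ) (hS : ∀ q ∈ S, 2 ≤ q) :
    ∑ q ∈ S, f q ≤ ∑ i ∈ Finset.range S.card, f (i + 2) := by
  induction S using Finset.induction_on_max with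
  | empty => simp
  | insert a s ha ih =>
    have hS' : ∀ q ∈ s, 2 ≤ q := fun q hq => hS q (Finset.mem_insert_of_mem hq)
    have hnot : a ∉ s := fun h' => lt_irrefl a (ha a h')
    have hcard : s.card + 2 ≤ a := by
      have hsub : s ⊆ Finset.Ico 2 a := fun x hx => Finset.mem_Ico.mpr ⟨hS' x hx, ha x hx⟩
      have h1 := Finset.card_le_card hsub
      rw [Nat.card_Ico] at h1
      have ha2 : 2 ≤ a := hS a (Finset.mem_insert_self a s)
      omega
    rw [Finset.sum_insert hnot, Finset.card_insert_of_notMem hnot, Finset.sum_range_succ]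
    have h2 := hf (s.card + 2) a (by omega) hcard
    linarith [ih hS']

/-- `Σ_{i<N} (i+2)^{−9/10} ≤ 10·(N+1)^{1/10}` (integral comparison with `∫_1^{N+1} x^{−9/10}dx`).
[folklore] -/
private theorem sum_range_rpow_le (N : ℕ) :
    ∑ i ∈ Finset.range N, ((i : ℝ) + 2) ^ (-(9 / 10 : ℝ)) ≤ 10 * ((N : ℝ) + 1) ^ (1 / 10 : ℝ) := by
  have hanti : AntitoneOn (fun x : ℝ => x ^ (-(9 / 10 : ℝ)))
      (Set.Icc ((1 : ℕ) : ℝ) ((N + 1 : ℕ) : ℝ)) := by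
    intro x hx y _ hxy
    have hx1 : (0 : ℝ) < x := by have := hx.1; push_cast at this; linarith
    exact Real.rpow_le_rpow_of_nonpos hx1 hxy (by norm_num)
  have hab : (1 : ℕ) ≤ N + 1 := by omega
  have h := AntitoneOn.sum_le_integral_Ico hab hanti
  rw [integral_rpow (Or.inl (by norm_num)), Finset.sum_Ico_eq_sum_range] at h
  simp only [Nat.add_sub_cancel] at h
  have hsum : ∑ i ∈ Finset.range N, ((i : ℝ) + 2) ^ (-(9 / 10 : ℝ)) =
      ∑ k ∈ Finset.range N, (((1 + k + 1 : ℕ) : ℝ)) ^ (-(9 / 10 : ℝ)) := by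
    refine Finset.sum_congr rfl fun k _ => ?_
    push_cast; ring_nf
  rw [hsum]
  refine h.trans ?_
  have hN0 : (0 : ℝ) ≤ (N : ℝ) + 1 := by positivity
  have e1 : (-(9 / 10 : ℝ)) + 1 = 1 / 10 := by norm_num
  rw [e1]
  push_cast
  rw [Real.one_rpow]
  have hpos : 0 ≤ ((N : ℝ) + 1) ^ (1 / 10 : ℝ) := Real.rpow_nonneg hN0 _
  rw [div_le_iff₀ (by norm_num : (0 : ℝ) < 1 / 10)]
  nlinarith

/-- `2^{ω(n)} ≤ n` for `n ≥ 1`. [folklore] -/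
private theorem two_pow_card_primeFactors_le {n : ℕ} (hn : 0 < n) : 2 ^ n.primeFactors.card ≤ n :=
  (Finset.pow_card_le_prod n.primeFactors (fun q => q) 2
    fun _ hq => (Nat.prime_of_mem_primeFactors hq).two_le).trans
    (Nat.le_of_dvd hn (Nat.prod_primeFactors_dvd n))

/-- `ω(n) ≤ 2𝓛⁹` for `1 ≤ n < P = e^{𝓛⁹}` (`2^{ω(n)} ≤ n`, `log 2 > 1/2`). [folklore] -/
private theorem card_primeFactors_le_ell {D n : ℕ} (hn0 : 0 < n) (hn : (n : ℝ) < bigP D) :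
    (n.primeFactors.card : ℝ) ≤ 2 * ell D ^ 9 := by
  have h1 : (2 : ℝ) ^ n.primeFactors.card ≤ n := by
    exact_mod_cast two_pow_card_primeFactors_le hn0
  have h2 : (2 : ℝ) ^ n.primeFactors.card < Real.exp (ell D ^ 9) := h1.trans_lt hn
  have h3 := Real.log_lt_log (by positivity) h2
  rw [Real.log_exp, Real.log_pow] at h3
  have hc : (0 : ℝ) ≤ n.primeFactors.card := Nat.cast_nonneg _
  nlinarith [Real.log_two_gt_d9, mul_le_mul_of_nonneg_left (le_of_lt Real.log_two_gt_d9) hc]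

/-- `3^{1/10} ≤ 6/5`. [folklore] -/
private theorem three_rpow_tenth_le : (3 : ℝ) ^ (1 / 10 : ℝ) ≤ 6 / 5 := by
  have h : (3 : ℝ) ≤ (6 / 5 : ℝ) ^ (10 : ℕ) := by norm_num
  calc (3 : ℝ) ^ (1 / 10 : ℝ) ≤ ((6 / 5 : ℝ) ^ (10 : ℕ)) ^ (1 / 10 : ℝ) :=
        Real.rpow_le_rpow (by norm_num) h (by norm_num)
    _ = 6 / 5 := by
        rw [← Real.rpow_natCast (6 / 5 : ℝ) 10, ← Real.rpow_mul (by norm_num)]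
        norm_num

/-- **`Σ_{q∣n} q^{−9/10} ≤ 12𝓛^{9/10}` for `1 ≤ n < P`** (`𝓛 ≥ 1`): the `ω(n) ≤ 2𝓛⁹` prime factors, in
increasing order, are at least `2, 3, …, ω(n)+1`, so the sum is at most
`Σ_{m=2}^{ω+1} m^{−9/10} ≤ 10(ω+1)^{1/10} ≤ 10·(3𝓛⁹)^{1/10} ≤ 12𝓛^{9/10}`. [folklore] -/
private theorem sum_primeFactors_rpow_le {D n : ℕ} (hℓ : 1 ≤ ell D) (hn0 : 0 < n) (hn : (n : ℝ) < bigP D) :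
    ∑ q ∈ n.primeFactors, (q : ℝ) ^ (-(9 / 10 : ℝ)) ≤ 12 * ell D ^ (9 / 10 : ℝ) := by
  set ω : ℕ := n.primeFactors.card with hωdef
  have hℓ0 : 0 ≤ ell D := by linarith
  have h1 : ∑ q ∈ n.primeFactors, (q : ℝ) ^ (-(9 / 10 : ℝ)) ≤
      ∑ i ∈ Finset.range ω, (((i + 2 : ℕ) : ℝ)) ^ (-(9 / 10 : ℝ)) :=
    sum_le_sum_range_of_antitone (f := fun m : ℕ => (m : ℝ) ^ (-(9 / 10 : ℝ)))
      (fun m k hm hmk => Real.rpow_le_rpow_of_nonpos (by positivity) (by exact_mod_cast hmk)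
        (by norm_num))
      n.primeFactors (fun q hq => (Nat.prime_of_mem_primeFactors hq).two_le)
  have h2 : ∑ i ∈ Finset.range ω, (((i + 2 : ℕ) : ℝ)) ^ (-(9 / 10 : ℝ)) ≤
      10 * ((ω : ℝ) + 1) ^ (1 / 10 : ℝ) := by
    have := sum_range_rpow_le ω
    refine le_trans (le_of_eq (Finset.sum_congr rfl fun i _ => ?_)) this
    push_cast; ring_nf
  have hω : (ω : ℝ) ≤ 2 * ell D ^ 9 := card_primeFactors_le_ell hn0 hn
  have hω1 : (ω : ℝ) + 1 ≤ 3 * ell D ^ 9 := by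
    have : (1 : ℝ) ≤ ell D ^ 9 := one_le_pow₀ hℓ
    linarith
  have h3 : ((ω : ℝ) + 1) ^ (1 / 10 : ℝ) ≤ (3 * ell D ^ 9) ^ (1 / 10 : ℝ) :=
    Real.rpow_le_rpow (by positivity) hω1 (by norm_num)
  have h4 : (3 * ell D ^ 9) ^ (1 / 10 : ℝ) = (3 : ℝ) ^ (1 / 10 : ℝ) * ell D ^ (9 / 10 : ℝ) := by
    rw [Real.mul_rpow (by norm_num) (by positivity)]
    congr 1
    rw [← Real.rpow_natCast (ell D) 9, ← Real.rpow_mul hℓ0]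
    norm_num
  have h5 : 0 ≤ ell D ^ (9 / 10 : ℝ) := Real.rpow_nonneg hℓ0 _
  calc ∑ q ∈ n.primeFactors, (q : ℝ) ^ (-(9 / 10 : ℝ))
      ≤ 10 * ((ω : ℝ) + 1) ^ (1 / 10 : ℝ) := h1.trans h2
    _ ≤ 10 * ((3 : ℝ) ^ (1 / 10 : ℝ) * ell D ^ (9 / 10 : ℝ)) := by rw [← h4]; gcongr
    _ ≤ 10 * ((6 / 5 : ℝ) * ell D ^ (9 / 10 : ℝ)) := by gcongr; exact three_rpow_tenth_le
    _ = 12 * ell D ^ (9 / 10 : ℝ) := by ring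

/-! ## Absorbing powers of `𝓛` into powers of `D` -/

/-- `ℓ^k·e^{−cℓ} ≤ 1` once `ℓ ≥ (k+1)!/c^{k+1}` (`c > 0`, `ℓ > 0`). [folklore] -/
private theorem pow_mul_exp_neg_le_one' {c ℓ : ℝ} (hc : 0 < c) (hℓ : 0 < ℓ) (k : ℕ)
    (hbig : (Nat.factorial (k + 1) : ℝ) / c ^ (k + 1) ≤ ℓ) : ℓ ^ k * Real.exp (-(c * ℓ)) ≤ 1 := by
  have h := Real.pow_div_factorial_le_exp (x := c * ℓ) (by positivity) (k + 1)
  have hfac : (0 : ℝ) < Nat.factorial (k + 1) := by exact_mod_cast Nat.factorial_pos _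
  have hck : 0 < c ^ (k + 1) := pow_pos hc _
  rw [Real.exp_neg, ← div_eq_mul_inv, div_le_one (Real.exp_pos _)]
  refine le_trans ?_ h
  rw [le_div_iff₀ hfac, mul_pow, pow_succ ℓ k]
  rw [div_le_iff₀ hck] at hbig
  have hℓk : 0 ≤ ℓ ^ k := pow_nonneg hℓ.le k
  nlinarith [mul_le_mul_of_nonneg_left hbig hℓk]

/-- **`𝓛⁸·D^{−9/10} ≤ D^{−1/2}`** once `𝓛 ≥ 9!/(2/5)⁹` (`𝓛⁸ ≤ D^{2/5} = e^{2𝓛/5}`). [folklore] -/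
private theorem ell_pow_eight_mul_rpow_le {D : ℕ} (hD : 0 < D)
    (hℓ : (Nat.factorial 9 : ℝ) / (2 / 5 : ℝ) ^ 9 ≤ ell D) :
    ell D ^ 8 * (D : ℝ) ^ (-(9 / 10 : ℝ)) ≤ (D : ℝ) ^ (-(1 / 2 : ℝ)) := by
  have hD0 : (0 : ℝ) < D := by exact_mod_cast hD
  have hℓ0 : 0 < ell D := lt_of_lt_of_le (by positivity) hℓ
  have h := pow_mul_exp_neg_le_one' (c := 2 / 5) (by norm_num) hℓ0 8 (by
    have : (Nat.factorial (8 + 1) : ℝ) / (2 / 5 : ℝ) ^ (8 + 1) = (Nat.factorial 9 : ℝ) / (2 / 5) ^ 9 := by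
      norm_num
    rw [this]; exact hℓ)
  have hDeq : (D : ℝ) = Real.exp (ell D) := by rw [ell, Real.exp_log hD0]
  have e1 : (D : ℝ) ^ (-(9 / 10 : ℝ)) = Real.exp (-(2 / 5 * ell D)) * (D : ℝ) ^ (-(1 / 2 : ℝ)) := by
    rw [hDeq, ← Real.exp_mul, ← Real.exp_mul, ← Real.exp_add]
    congr 1; ring
  rw [e1, ← mul_assoc]
  have hpos : 0 ≤ (D : ℝ) ^ (-(1 / 2 : ℝ)) := Real.rpow_nonneg hD0.le _
  calc ell D ^ 8 * Real.exp (-(2 / 5 * ell D)) * (D : ℝ) ^ (-(1 / 2 : ℝ))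
      ≤ 1 * (D : ℝ) ^ (-(1 / 2 : ℝ)) := mul_le_mul_of_nonneg_right h hpos
    _ = (D : ℝ) ^ (-(1 / 2 : ℝ)) := one_mul _

/-- **`exp(48𝓛^{9/10}) ≤ D^{1/5}`** once `𝓛 ≥ 240¹⁰` (`𝓛 = 𝓛^{9/10}𝓛^{1/10} ≥ 240𝓛^{9/10}`). [folklore] -/
private theorem exp_ell_rpow_le {D : ℕ} (hD : 0 < D) (hℓ : (240 : ℝ) ^ (10 : ℕ) ≤ ell D) :
    Real.exp (48 * ell D ^ (9 / 10 : ℝ)) ≤ (D : ℝ) ^ (1 / 5 : ℝ) := by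
  have hD0 : (0 : ℝ) < D := by exact_mod_cast hD
  have hℓ0 : 0 < ell D := lt_of_lt_of_le (by positivity) hℓ
  have hDeq : (D : ℝ) ^ (1 / 5 : ℝ) = Real.exp (ell D / 5) := by
    rw [Real.rpow_def_of_pos hD0, show Real.log (D : ℝ) = ell D from rfl]
    congr 1; ring
  rw [hDeq, Real.exp_le_exp]
  have h1 : (240 : ℝ) ≤ ell D ^ (1 / 10 : ℝ) := by
    calc (240 : ℝ) = ((240 : ℝ) ^ (10 : ℕ)) ^ (1 / 10 : ℝ) := by
          rw [← Real.rpow_natCast (240 : ℝ) 10, ← Real.rpow_mul (by norm_num)]; norm_num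
      _ ≤ ell D ^ (1 / 10 : ℝ) := Real.rpow_le_rpow (by positivity) hℓ (by norm_num)
  have h2 : ell D = ell D ^ (9 / 10 : ℝ) * ell D ^ (1 / 10 : ℝ) := by
    rw [← Real.rpow_add hℓ0]; norm_num
  have h3 : 0 ≤ ell D ^ (9 / 10 : ℝ) := Real.rpow_nonneg hℓ0.le _
  have h4 : 240 * ell D ^ (9 / 10 : ℝ) ≤ ell D := by
    have h5 : ell D ^ (9 / 10 : ℝ) * 240 ≤ ell D ^ (9 / 10 : ℝ) * ell D ^ (1 / 10 : ℝ) :=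
      mul_le_mul_of_nonneg_left h1 h3
    rw [← h2] at h5
    linarith
  linarith

/-- `log D ≥ L₀` once `D ≥ ⌈exp L₀⌉₊`. [folklore] -/
private theorem ell_ge_of_ge_ceil_exp' {L₀ : ℝ} {D : ℕ} (hD : ⌈Real.exp L₀⌉₊ ≤ D) : L₀ ≤ ell D := by
  have hD' : Real.exp L₀ ≤ D := le_trans (Nat.le_ceil _) (by exact_mod_cast hD)
  have hD0 : (0 : ℝ) < D := lt_of_lt_of_le (Real.exp_pos _) hD'
  rw [ell]; exact (Real.le_log_iff_exp_le hD0).mpr hD'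

/-! ## The tail of the Euler product on `σ > 9/10`, absolute form -/

/-- **The tail of the Euler product of `𝒰_j(d,h;s)` on `σ > 9/10`, ABSOLUTE form** (the Euler-product
half of Z22:§A.u007, App. A p. 101 tex L5000, prefactor-free reading): there are absolute `C` and `D₁`
such that for every `D ≥ D₁`, every Dirichlet character `χ` mod `D`, `1 ≤ j ≤ 3`, `d, h ≥ 1` with
`dh < P`, and every `s` with `σ > 9/10`,
`‖∏'_q 𝔱_j(d,h,s;q) − ∏_{q<D} 𝔱_j(d,h,s;q)‖ ≤ C·D^{−3/10}`.
Proof: `∏' − ∏_{q<D} = ∏_{q<D}·(∏_{q≥D} − 1)` with `‖∏_{q≥D} − 1‖ ≤ e^T − 1 ≤ Te^T`,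
`T = Σ_{q≥D} b_q ≤ (26·10⁶ζ(13/10) + 4)·D^{−1/2}` (`q^{−9/5} ≤ D^{−1/2}q^{−13/10}` for `q ≥ D`; the
`≤ 𝓛⁸` primes `q ≥ D` dividing `dh` give `4𝓛⁸D^{−9/10} ≤ 4D^{−1/2}`), and
`‖∏_{q<D}‖ ≤ exp(26·10⁶ζ(9/5) + 4Σ_{q∣dh}q^{−9/10}) ≤ exp(26·10⁶ζ(9/5))·D^{1/5}` (`sum_primeFactors_rpow_le`,
`𝓛 ≥ 240¹⁰`). No Assumption (A), no primitivity or quadraticity of `χ` is used.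
[cite: Zhang2022LandauSiegel, App. A p. 101, tex L5000] -/
theorem norm_tprod_frakt_sub_prod_le (c' : ℝ) :
    ∃ C : ℝ, ∃ D₁ : ℕ, ∀ (D : ℕ) (χ : DirichletCharacter ℂ D), D₁ ≤ D →
      ∀ j ∈ ({1, 2, 3} : Finset ℕ), ∀ d h : ℕ, 1 ≤ d → 1 ≤ h → ((d * h : ℕ) : ℝ) < bigP D →
        ∀ s : ℂ, 9 / 10 < s.re →
          ‖(∏' q : Nat.Primes, frakt c' χ j d h s q) -
              ∏ q ∈ Nat.primesBelow D, frakt c' χ j d h s q‖ ≤ C * (D : ℝ) ^ (-(3 / 10 : ℝ)) := by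
  classical
  -- absolute constants
  have hZsum : Summable fun n : ℕ => (n : ℝ) ^ (-(13 / 10 : ℝ)) :=
    Real.summable_nat_rpow.mpr (by norm_num)
  have hKsum : Summable fun n : ℕ => (n : ℝ) ^ (-(9 / 5 : ℝ)) :=
    Real.summable_nat_rpow.mpr (by norm_num)
  set Z : ℝ := ∑' n : ℕ, (n : ℝ) ^ (-(13 / 10 : ℝ)) with hZdef
  set K : ℝ := ∑' n : ℕ, (n : ℝ) ^ (-(9 / 5 : ℝ)) with hKdef
  have hZ0 : 0 ≤ Z := tsum_nonneg fun n => Real.rpow_nonneg (Nat.cast_nonneg n) _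
  have hK0 : 0 ≤ K := tsum_nonneg fun n => Real.rpow_nonneg (Nat.cast_nonneg n) _
  set CT : ℝ := 26000000 * Z + 4 with hCTdef
  have hCT0 : 0 ≤ CT := by positivity
  set C : ℝ := Real.exp (26000000 * K) * (CT * Real.exp CT) with hCdef
  set L₀ : ℝ := (240 : ℝ) ^ (10 : ℕ) with hL₀def
  set D₁ : ℕ := ⌈Real.exp L₀⌉₊ with hD₁def
  refine ⟨C, D₁, fun D χ hD j hj d h hd hh hdh s hs => ?_⟩
  -- largeness consequences
  have hℓL₀ : L₀ ≤ ell D := ell_ge_of_ge_ceil_exp' hD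
  have hℓ240 : (240 : ℝ) ^ (10 : ℕ) ≤ ell D := hℓL₀
  have hℓ1 : 1 ≤ ell D := le_trans (by norm_num) hℓ240
  have hℓ0 : 0 < ell D := by linarith
  have hℓfac : (Nat.factorial 9 : ℝ) / (2 / 5 : ℝ) ^ 9 ≤ ell D := le_trans (by norm_num) hℓ240
  have hDpos : 0 < D := by
    by_contra h0
    have : D = 0 := by omega
    have : ell D = 0 := by rw [ell, this]; simp
    linarith
  have hD0 : (0 : ℝ) < D := by exact_mod_cast hDpos
  have hD1 : (1 : ℝ) ≤ D := by exact_mod_cast hDpos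
  have hdh0 : 0 < d * h := Nat.mul_pos hd hh
  -- the factors, the finite set, the multipliability
  set F : Nat.Primes → ℂ := fun q => frakt c' χ j d h s q with hFdef
  set S : Finset Nat.Primes := (Nat.primesBelow D).subtype Nat.Prime with hSdef
  have hP : ∏ q ∈ Nat.primesBelow D, frakt c' χ j d h s q = ∏ q ∈ S, F q := by
    have h1 : ∏ q ∈ S, F q = ∏ q ∈ (Nat.primesBelow D).filter Nat.Prime,
        frakt c' χ j d h s q :=
      Finset.prod_subtype_eq_prod_filter (fun q : ℕ => frakt c' χ j d h s q)
    rw [h1, Finset.filter_true_of_mem fun q hq => Nat.prime_of_mem_primesBelow hq]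
  have hmultF : Multipliable F := multipliable_frakt c' χ hj hd hh s hs
  -- the majorant `b = b₁ + b₂` of `‖F_q − 1‖` off `S` (i.e. for `q ≥ D`)
  set b₁ : Nat.Primes → ℝ := fun q =>
    if (q : ℕ) < D then 0 else 26000000 * ((q : ℕ) : ℝ) ^ (-(9 / 5 : ℝ)) with hb₁
  set b₂ : Nat.Primes → ℝ := fun q =>
    if (q : ℕ) < D then 0 else
      if (q : ℕ) ∣ d * h then 4 * ((q : ℕ) : ℝ) ^ (-(9 / 10 : ℝ)) else 0 with hb₂
  have hb₁0 : ∀ q, 0 ≤ b₁ q := fun q => by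
    simp only [hb₁]; split_ifs <;> positivity
  have hb₂0 : ∀ q, 0 ≤ b₂ q := fun q => by
    simp only [hb₂]; split_ifs <;> positivity
  have hb0 : ∀ q, 0 ≤ b₁ q + b₂ q := fun q => add_nonneg (hb₁0 q) (hb₂0 q)
  have hFb : ∀ q ∉ S, ‖F q - 1‖ ≤ b₁ q + b₂ q := by
    intro q hqS
    have hqprime : (q : ℕ).Prime := q.prop
    have hqD : ¬ (q : ℕ) < D := fun h' =>
      hqS (Finset.mem_subtype.mpr (Nat.mem_primesBelow.mpr ⟨h', hqprime⟩))
    have hb := norm_frakt_sub_one_le_all c' χ hj hd hh hqprime s hs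
    simp only [hb₁, hb₂, if_neg hqD, hFdef]
    exact hb
  -- `Σ' b₁ ≤ 26·10⁶·Z·D^{−1/2}`
  set g₁ : ℕ → ℝ := fun n => if n < D then 0 else 26000000 * (n : ℝ) ^ (-(9 / 5 : ℝ)) with hg₁
  have hg₁0 : ∀ n, 0 ≤ g₁ n := fun n => by simp only [hg₁]; split_ifs <;> positivity
  have hg₁le : ∀ n, g₁ n ≤ 26000000 * (D : ℝ) ^ (-(1 / 2 : ℝ)) * (n : ℝ) ^ (-(13 / 10 : ℝ)) := by
    intro n
    simp only [hg₁]
    split_ifs with hn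
    · positivity
    · have hn' : (D : ℝ) ≤ n := by exact_mod_cast not_lt.mp hn
      have hn0 : (0 : ℝ) < n := lt_of_lt_of_le hD0 hn'
      have hsplit : (n : ℝ) ^ (-(9 / 5 : ℝ)) = (n : ℝ) ^ (-(1 / 2 : ℝ)) * (n : ℝ) ^ (-(13 / 10 : ℝ)) := by
        rw [← Real.rpow_add hn0]; norm_num
      have hmono : (n : ℝ) ^ (-(1 / 2 : ℝ)) ≤ (D : ℝ) ^ (-(1 / 2 : ℝ)) :=
        Real.rpow_le_rpow_of_nonpos hD0 hn' (by norm_num)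
      rw [hsplit, ← mul_assoc]
      gcongr
  have hg₁sum : Summable g₁ :=
    Summable.of_nonneg_of_le hg₁0 hg₁le (hZsum.mul_left _)
  have hb₁sum : Summable b₁ := by
    have : b₁ = g₁ ∘ (fun q : Nat.Primes => (q : ℕ)) := by
      funext q; simp only [hb₁, hg₁, Function.comp]
    rw [this]
    exact hg₁sum.comp_injective Subtype.val_injective
  have htsum₁ : ∑' q, b₁ q ≤ 26000000 * Z * (D : ℝ) ^ (-(1 / 2 : ℝ)) := by
    have h1 : ∑' q, b₁ q ≤ ∑' n, g₁ n :=
      hb₁sum.tsum_le_tsum_of_inj (fun q : Nat.Primes => (q : ℕ)) Subtype.val_injective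
        (fun n _ => hg₁0 n) (fun q => by simp only [hb₁, hg₁]; exact le_rfl) hg₁sum
    have h2 : ∑' n, g₁ n ≤ ∑' n : ℕ, 26000000 * (D : ℝ) ^ (-(1 / 2 : ℝ)) * (n : ℝ) ^ (-(13 / 10 : ℝ)) :=
      hg₁sum.tsum_le_tsum hg₁le (hZsum.mul_left _)
    rw [tsum_mul_left] at h2
    calc ∑' q, b₁ q ≤ 26000000 * (D : ℝ) ^ (-(1 / 2 : ℝ)) * Z := h1.trans h2
      _ = 26000000 * Z * (D : ℝ) ^ (-(1 / 2 : ℝ)) := by ring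
  -- `Σ' b₂ ≤ 4·𝓛⁸·D^{−9/10} ≤ 4·D^{−1/2}`
  set S₂ : Finset Nat.Primes := (d * h).primeFactors.subtype Nat.Prime with hS₂def
  have hb₂zero : ∀ q ∉ S₂, b₂ q = 0 := by
    intro q hq
    have hndvd : ¬ (q : ℕ) ∣ d * h := fun h' =>
      hq (Finset.mem_subtype.mpr (Nat.mem_primeFactors.mpr ⟨q.prop, h', hdh0.ne'⟩))
    simp only [hb₂, if_neg hndvd]
    split_ifs <;> rfl
  have hb₂sum : Summable b₂ := summable_of_ne_finset_zero hb₂zero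
  have htsum₂ : ∑' q, b₂ q ≤ 4 * (D : ℝ) ^ (-(1 / 2 : ℝ)) := by
    rw [tsum_eq_sum hb₂zero]
    set g₂ : ℕ → ℝ := fun n => if n < D then 0 else
      if n ∣ d * h then 4 * (n : ℝ) ^ (-(9 / 10 : ℝ)) else 0 with hg₂
    have hsum : ∑ q ∈ S₂, b₂ q = ∑ n ∈ (d * h).primeFactors, g₂ n := by
      have h1 : ∑ q ∈ S₂, b₂ q = ∑ n ∈ (d * h).primeFactors.filter Nat.Prime, g₂ n :=
        Finset.sum_subtype_eq_sum_filter g₂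
      rw [h1, Finset.filter_true_of_mem fun n hn => Nat.prime_of_mem_primeFactors hn]
    rw [hsum]
    set T := (d * h).primeFactors.filter fun q => D ≤ q with hTdef
    have hle : ∀ n ∈ (d * h).primeFactors,
        g₂ n ≤ if D ≤ n then 4 * (D : ℝ) ^ (-(9 / 10 : ℝ)) else 0 := by
      intro n _
      simp only [hg₂]
      by_cases hn : n < D
      · rw [if_pos hn, if_neg (not_le.mpr hn)]
      · rw [if_neg hn, if_pos (not_lt.mp hn)]
        have hn' : (D : ℝ) ≤ n := by exact_mod_cast not_lt.mp hn
        split_ifs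
        · exact mul_le_mul_of_nonneg_left (Real.rpow_le_rpow_of_nonpos hD0 hn' (by norm_num))
            (by norm_num)
        · positivity
    have hcard : ((T.card : ℕ) : ℝ) ≤ ell D ^ 8 := card_primeFactors_ge_le hℓ0 hdh0 hdh
    have h8 := ell_pow_eight_mul_rpow_le hDpos hℓfac
    calc ∑ n ∈ (d * h).primeFactors, g₂ n
        ≤ ∑ n ∈ (d * h).primeFactors, (if D ≤ n then 4 * (D : ℝ) ^ (-(9 / 10 : ℝ)) else 0) :=
          Finset.sum_le_sum hle
      _ = T.card * (4 * (D : ℝ) ^ (-(9 / 10 : ℝ))) := by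
          rw [Finset.sum_ite, Finset.sum_const_zero, add_zero, Finset.sum_const, nsmul_eq_mul]
      _ ≤ ell D ^ 8 * (4 * (D : ℝ) ^ (-(9 / 10 : ℝ))) := by gcongr
      _ = 4 * (ell D ^ 8 * (D : ℝ) ^ (-(9 / 10 : ℝ))) := by ring
      _ ≤ 4 * (D : ℝ) ^ (-(1 / 2 : ℝ)) := by gcongr
  -- the total tail majorant `T ≤ CT·D^{−1/2} ≤ CT`
  have hbsum : Summable fun q => b₁ q + b₂ q := hb₁sum.add hb₂sum
  have htsum : ∑' q, (b₁ q + b₂ q) ≤ CT * (D : ℝ) ^ (-(1 / 2 : ℝ)) := by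
    rw [hb₁sum.tsum_add hb₂sum, hCTdef]
    nlinarith [htsum₁, htsum₂]
  have htsum0 : 0 ≤ ∑' q, (b₁ q + b₂ q) := tsum_nonneg hb0
  have hDneg : (D : ℝ) ^ (-(1 / 2 : ℝ)) ≤ 1 :=
    Real.rpow_le_one_of_one_le_of_nonpos hD1 (by norm_num)
  have htsumC : ∑' q, (b₁ q + b₂ q) ≤ CT := htsum.trans (by nlinarith)
  have hexp : Real.exp (∑' q, (b₁ q + b₂ q)) - 1 ≤ CT * Real.exp CT * (D : ℝ) ^ (-(1 / 2 : ℝ)) :=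
    calc Real.exp (∑' q, (b₁ q + b₂ q)) - 1
        ≤ (∑' q, (b₁ q + b₂ q)) * Real.exp (∑' q, (b₁ q + b₂ q)) := exp_sub_one_le_mul_exp' _
      _ ≤ (CT * (D : ℝ) ^ (-(1 / 2 : ℝ))) * Real.exp CT := by gcongr
      _ = CT * Real.exp CT * (D : ℝ) ^ (-(1 / 2 : ℝ)) := by ring
  -- the finite part: `‖∏_S F‖ ≤ exp(26·10⁶·K)·D^{1/5}`
  have hfin : ‖∏ q ∈ S, F q‖ ≤ Real.exp (26000000 * K) * (D : ℝ) ^ (1 / 5 : ℝ) := by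
    have h1 : ‖∏ q ∈ S, F q‖ ≤ Real.exp (∑ q ∈ S, ‖F q - 1‖) := norm_prod_le_exp_sum S F
    -- move the sum to `ℕ`
    set g : ℕ → ℝ := fun q => ‖frakt c' χ j d h s q - 1‖ with hgdef
    have hSg : ∑ q ∈ S, ‖F q - 1‖ = ∑ q ∈ Nat.primesBelow D, g q := by
      have h2 : ∑ q ∈ S, ‖F q - 1‖ = ∑ q ∈ (Nat.primesBelow D).filter Nat.Prime, g q :=
        Finset.sum_subtype_eq_sum_filter g
      rw [h2, Finset.filter_true_of_mem fun q hq => Nat.prime_of_mem_primesBelow hq]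
    have hgle : ∑ q ∈ Nat.primesBelow D, g q ≤
        26000000 * K + 4 * ∑ q ∈ (d * h).primeFactors, (q : ℝ) ^ (-(9 / 10 : ℝ)) := by
      have hstep : ∑ q ∈ Nat.primesBelow D, g q ≤
          ∑ q ∈ Nat.primesBelow D, (26000000 * (q : ℝ) ^ (-(9 / 5 : ℝ)) +
            (if q ∣ d * h then 4 * (q : ℝ) ^ (-(9 / 10 : ℝ)) else 0)) :=
        Finset.sum_le_sum fun q hq =>
          norm_frakt_sub_one_le_all c' χ hj hd hh (Nat.prime_of_mem_primesBelow hq) s hs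
      refine hstep.trans ?_
      rw [Finset.sum_add_distrib, ← Finset.mul_sum, ← Finset.sum_filter]
      have hA : ∑ q ∈ Nat.primesBelow D, (q : ℝ) ^ (-(9 / 5 : ℝ)) ≤ K :=
        hKsum.sum_le_tsum _ (fun q _ => Real.rpow_nonneg (Nat.cast_nonneg q) _)
      have hB : ∑ q ∈ (Nat.primesBelow D).filter (fun q => q ∣ d * h),
          4 * (q : ℝ) ^ (-(9 / 10 : ℝ)) ≤
            4 * ∑ q ∈ (d * h).primeFactors, (q : ℝ) ^ (-(9 / 10 : ℝ)) := by
        rw [← Finset.mul_sum]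
        refine mul_le_mul_of_nonneg_left ?_ (by norm_num)
        refine Finset.sum_le_sum_of_subset_of_nonneg ?_ (fun q _ _ => Real.rpow_nonneg (Nat.cast_nonneg q) _)
        intro q hq
        obtain ⟨hq1, hq2⟩ := Finset.mem_filter.mp hq
        exact Nat.mem_primeFactors.mpr ⟨(Nat.mem_primesBelow.mp hq1).2, hq2, hdh0.ne'⟩
      linarith
    have hω : ∑ q ∈ (d * h).primeFactors, (q : ℝ) ^ (-(9 / 10 : ℝ)) ≤ 12 * ell D ^ (9 / 10 : ℝ) :=
      sum_primeFactors_rpow_le hℓ1 hdh0 hdh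
    have habs : Real.exp (48 * ell D ^ (9 / 10 : ℝ)) ≤ (D : ℝ) ^ (1 / 5 : ℝ) := exp_ell_rpow_le hDpos hℓ240
    calc ‖∏ q ∈ S, F q‖ ≤ Real.exp (∑ q ∈ S, ‖F q - 1‖) := h1
      _ ≤ Real.exp (26000000 * K + 48 * ell D ^ (9 / 10 : ℝ)) := by
          rw [Real.exp_le_exp, hSg]; linarith
      _ = Real.exp (26000000 * K) * Real.exp (48 * ell D ^ (9 / 10 : ℝ)) := Real.exp_add _ _
      _ ≤ Real.exp (26000000 * K) * (D : ℝ) ^ (1 / 5 : ℝ) :=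
          mul_le_mul_of_nonneg_left habs (Real.exp_pos _).le
  -- the tail lemma and the assembly
  have key := norm_hasProd_sub_prod_le' hmultF.hasProd S hb0 hbsum hFb
  have hpow : (D : ℝ) ^ (1 / 5 : ℝ) * (D : ℝ) ^ (-(1 / 2 : ℝ)) = (D : ℝ) ^ (-(3 / 10 : ℝ)) := by
    rw [← Real.rpow_add hD0]; norm_num
  have hexp0 : 0 ≤ Real.exp (∑' q, (b₁ q + b₂ q)) - 1 := by
    linarith [Real.add_one_le_exp (∑' q, (b₁ q + b₂ q))]
  calc ‖(∏' q : Nat.Primes, frakt c' χ j d h s q) - ∏ q ∈ Nat.primesBelow D, frakt c' χ j d h s q‖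
      = ‖(∏' q, F q) - ∏ q ∈ S, F q‖ := by rw [hP]
    _ ≤ ‖∏ q ∈ S, F q‖ * (Real.exp (∑' q, (b₁ q + b₂ q)) - 1) := key
    _ ≤ (Real.exp (26000000 * K) * (D : ℝ) ^ (1 / 5 : ℝ)) *
          (CT * Real.exp CT * (D : ℝ) ^ (-(1 / 2 : ℝ))) :=
        mul_le_mul hfin hexp hexp0 (by positivity)
    _ = C * ((D : ℝ) ^ (1 / 5 : ℝ) * (D : ℝ) ^ (-(1 / 2 : ℝ))) := by rw [hCdef]; ring
    _ = C * (D : ℝ) ^ (-(3 / 10 : ℝ)) := by rw [hpow]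

end Literature.NumberTheory.LFunctions.Zhang2022.Lemma83

end
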